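import Summits.ResolutionOfSingularities.ResolutionOfSingularities.Theorems.EquisingularLiftEquisingularLiftNatLinearCentreKill
import Summits.ResolutionOfSingularities.ResolutionOfSingularities.Theorems.EquisingularLiftEquisingularLiftGoodAtOfSmooth
import Literature.AlgebraicGeometry.Resolution.ResolutionGlue
import HarnessLib

/-!
# [OURS · L1 W4.5(b)] EL♮ helper (R1, part 2) — LINEAR CENTRES OVER `O` IN THE EL♮ AMBIENT: regular, `O`-flat, special
# fibre = the `k`-linear subspace, off the generic point of `Y`, non-zero

Cell res-hironaka, LADDER-RESOLUTION rung L (D-0089), slot W4.5(b), crux `Theses.EquisingularLift.EquisingularLiftNat`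
(stmt-ResolutionOfSingularities-20038), object **(R1)** of res-L1-w45b-plan-1's ORDERS 2026-08-27T05:49:16Z,
`--supports stmt-ResolutionOfSingularities-20038 --as helper`. NOT a statement of any manuscript; OURS structural facts about
the EL♮ ambient `P = Proj O[x_0..x_N] → Spec O`. AI-written; AI review is weaker than expert review.

SETTING (the EL♮ item's spelling). `O` a commutative ring (a DVR where regularity is concerned), `π : O → k` a surjection onto
a commutative ring `k` (a field in the item), `φ : O[x] →ᵍ k[x]` the graded coefficient map (`φ s = MvPolynomial.map π s`) with
the `Proj.map` hypothesis `hφ'`, `g := Proj.map φ hφ' : ℙ^N_k → ℙ^N_O = P` (the special fibre), `q := Proj.toSpecZero _ ≫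
Spec.map (algebraMap O (O[x])₀) : P → Spec O`, `s₀ := IsLocalRing.closedPoint O`. A set of SURVIVING variables is an injective
`e : Fin (r+1) → Fin (N+1)`; the kill maps `f_O`, `f_k` of the variables outside `range e` are carried DEF-FREE (hypotheses
`f (C a) = C a`, `f (X (e j)) = X j`, `f (X i) = 0` for `i ∉ range e`; they exist, `LinearCentre.exists_kill`, part 1), and the
**linear centre** is the kernel ideal sheaf `Λ := (Proj.map f_O _).ker` of the closed immersion `ℙ^r_O → ℙ^N_O`, with special
fibre `Λ_k := (Proj.map f_k _).ker`.

RESULTS (the four properties asked for by the ORDERS, in the currency of the HorizChainE1 step hypotheses of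
`natChain_and_isIrreducible_of_horizChainE1`, p500485, plus the base change needed downstairs):
* `isRegular_kerSubscheme` — `V(Λ) ≅ ℙ^r_O` is a regular scheme (`O` a DVR; smooth over a regular base);
* `flat_kerSubschemeι_comp` — `V(Λ) → Spec O` is flat (it IS the structure morphism of `ℙ^r_O`, which is smooth);
* `ker_projMap_kill_eq_comap` (part 1) — `Λ_k = Λ · 𝒪_{ℙ^N_k}`; `preimage_support` — `g⁻¹ supp Λ = supp Λ_k`;
* `range_projMap_eq_specialFibre` — `range g = q⁻¹ {s₀}` (`O` local, `k` a field); `support_inter_specialFibre` —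
  `supp Λ ∩ q⁻¹{s₀} = g '' supp Λ_k`, and the E1-ready `support_inter_specialFibre_subset_range`: if `supp Λ_k ⊆ range ι` then
  `supp Λ ∩ (𝟙 ≫ q)⁻¹{s₀} ⊆ range (ι ≫ g)`;
* `image_support_subset_nonGeneric` — if some point of an integral closed `H ↪ ℙ^N_k` is off `supp Λ_k`, then `supp Λ` is
  off the generic point of `Y = (ι ≫ g)(H)` (the HorizChainE1 «off-generic» clause at level 0);
* `linearCentre_stepData` — the four step clauses bundled in the order of p500485 (res-L1-w45b-plan-1 06:10:19Z).
Points of `supp Λ_k` (vanishing of the killed variables) and `Λ ≠ 0`: sibling file `…NatLinearCentrePoints.lean`.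

References: p-tree `…LinearCentreLift.lean` (`EL_of_linearCentre`, whose centre paragraph is transcribed here for arbitrary `e`),
`…NatHorizChain.lean` p500485 (consumer interface) — OURS, index only; [Hartshorne1977, II Prop. 5.9, Ex. 3.12 (a)];
[Liu2002, Prop. 3.1.9, Ex. 3.1.10].
-/

set_option linter.dupNamespace false -- mandated namespace `Summit.<Summit>.<Problem>` of this single-conjunct summit
set_option linter.overlappingInstances false -- signatures carry `[IsDomain O] [IsDiscreteValuationRing O]` as in the item

noncomputable section

open CategoryTheory CategoryTheory.Limits AlgebraicGeometry TopologicalSpace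
open MvPolynomial HomogeneousLocalization
open Literature.AlgebraicGeometry.Resolution
open AlgebraicGeometry.Scheme.IdealSheafData
open Summit.ResolutionOfSingularities.ResolutionOfSingularities.Cruxes.EquisingularLift.StrataSplit

attribute [local instance] MvPolynomial.gradedAlgebra
attribute [local instance] Literature.AlgebraicGeometry.Motives.ProjBaseChange.algebraBase

namespace Summit.ResolutionOfSingularities.ResolutionOfSingularities.Cruxes.EquisingularLiftNat

namespace LinearCentre

/-! ## The linear centre over `O`: regular and `O`-flat -/

section OverO

variable {O : Type} [CommRing O] {N r : ℕ} (e : Fin (r + 1) → Fin (N + 1))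
  (fO : (homogeneousSubmodule (Fin (N + 1)) O) →+*ᵍ (homogeneousSubmodule (Fin (r + 1)) O))
  (hfO' : HomogeneousIdeal.irrelevant (homogeneousSubmodule (Fin (r + 1)) O) ≤
    (HomogeneousIdeal.irrelevant (homogeneousSubmodule (Fin (N + 1)) O)).map fO)
  (hfOC : ∀ a : O, fO (C a) = C a) (hfOe : ∀ j : Fin (r + 1), fO (X (e j)) = X j)

include hfOC hfOe in
/-- `Proj` of the kill map `ℙ^r_O → ℙ^N_O` is a closed immersion (the kill map is surjective). [cite: Hartshorne1977, II Ex. 3.12 (a)] -/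
theorem isClosedImmersion_projMap_kill : IsClosedImmersion (Proj.map fO hfO') :=
  Literature.AlgebraicGeometry.FundamentalGroup.isClosedImmersion_projMap_of_surjective fO hfO'
    (fun q => ⟨_, kill_rename e fO.toRingHom (fun a => hfOC a) (fun j => hfOe j) q⟩)

include hfOC hfOe in
/-- **The linear centre is regular**: `V(Λ) ≅ ℙ^r_O` (image of the closed immersion `Proj f_O`) and `ℙ^r_O` is smooth over
the discrete valuation ring `O`, hence regular (`stub_goodAtOfSmooth`). [folklore] -/
theorem isRegular_kerSubscheme [IsDomain O] [IsDiscreteValuationRing O] :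
    Scheme.IsRegular (Proj.map fO hfO').ker.subscheme := by
  have hsm := (stub_projectiveAmbientSmoothProper O r).1
  have hRr : Scheme.IsRegular (Proj (homogeneousSubmodule (Fin (r + 1)) O)) := fun y =>
    (stub_goodAtOfSmooth O _ _ hsm y).1
  haveI := isClosedImmersion_projMap_kill e fO hfO' hfOC hfOe
  exact hRr.of_iso (Proj.map fO hfO').toImage

include hfOC hfOe in
/-- **The linear centre is flat over `Spec O`**: `V(Λ) → ℙ^N_O → Spec O` is, through `V(Λ) ≅ ℙ^r_O`, the structure morphism
of `ℙ^r_O` (`projMap_kill_comp_structureMap`), which is smooth, hence flat. [folklore] -/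
theorem flat_kerSubschemeι_comp :
    Flat ((Proj.map fO hfO').ker.subschemeι ≫ (Proj.toSpecZero (homogeneousSubmodule (Fin (N + 1)) O) ≫
      Spec.map (CommRingCat.ofHom (algebraMap O ((homogeneousSubmodule (Fin (N + 1)) O) 0))))) := by
  haveI := isClosedImmersion_projMap_kill e fO hfO' hfOC hfOe
  set iO := Proj.map fO hfO' with hiO
  have h1 : iO.toImage ≫ iO.ker.subschemeι ≫ (Proj.toSpecZero (homogeneousSubmodule (Fin (N + 1)) O) ≫
        Spec.map (CommRingCat.ofHom (algebraMap O ((homogeneousSubmodule (Fin (N + 1)) O) 0)))) =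
      Proj.toSpecZero (homogeneousSubmodule (Fin (r + 1)) O) ≫
        Spec.map (CommRingCat.ofHom (algebraMap O (homogeneousSubmodule (Fin (r + 1)) O 0))) := by
    rw [← Category.assoc]
    change (iO.toImage ≫ iO.imageι) ≫ _ = _
    rw [Scheme.Hom.toImage_imageι]
    exact projMap_kill_comp_structureMap e fO hfO' hfOC hfOe
  haveI := (stub_projectiveAmbientSmoothProper O r).1
  have h2 : Flat (iO.toImage ≫ iO.ker.subschemeι ≫ (Proj.toSpecZero (homogeneousSubmodule (Fin (N + 1)) O) ≫
      Spec.map (CommRingCat.ofHom (algebraMap O ((homogeneousSubmodule (Fin (N + 1)) O) 0))))) := by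
    rw [h1]; infer_instance
  exact (MorphismProperty.cancel_left_of_respectsIso @Flat iO.toImage _).mp h2

include hfOC hfOe in
/-- The flatness clause in the shape of a level-0 HorizChainE1 step (`σ' = 𝟙`). [folklore] -/
theorem flat_kerSubschemeι_comp_id :
    Flat ((Proj.map fO hfO').ker.subschemeι ≫ 𝟙 _ ≫ (Proj.toSpecZero (homogeneousSubmodule (Fin (N + 1)) O) ≫
      Spec.map (CommRingCat.ofHom (algebraMap O ((homogeneousSubmodule (Fin (N + 1)) O) 0))))) := by
  rw [Category.id_comp]
  exact flat_kerSubschemeι_comp e fO hfO' hfOC hfOe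

end OverO

/-! ## The special fibre of the linear centre -/

section SpecialFibre

variable {O k : Type} [CommRing O] [CommRing k] (π : O →+* k) (hπ : Function.Surjective π) {N r : ℕ}
  (e : Fin (r + 1) → Fin (N + 1))
  (φ : (homogeneousSubmodule (Fin (N + 1)) O) →+*ᵍ (homogeneousSubmodule (Fin (N + 1)) k))
  (hφ : ∀ q, φ q = MvPolynomial.map π q)
  (hφ' : HomogeneousIdeal.irrelevant (homogeneousSubmodule (Fin (N + 1)) k) ≤
    (HomogeneousIdeal.irrelevant (homogeneousSubmodule (Fin (N + 1)) O)).map φ)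
  (fO : (homogeneousSubmodule (Fin (N + 1)) O) →+*ᵍ (homogeneousSubmodule (Fin (r + 1)) O))
  (hfO' : HomogeneousIdeal.irrelevant (homogeneousSubmodule (Fin (r + 1)) O) ≤
    (HomogeneousIdeal.irrelevant (homogeneousSubmodule (Fin (N + 1)) O)).map fO)
  (hfOC : ∀ a : O, fO (C a) = C a) (hfOe : ∀ j : Fin (r + 1), fO (X (e j)) = X j)
  (hfO0 : ∀ i : Fin (N + 1), i ∉ Set.range e → fO (X i) = 0)
  (fk : (homogeneousSubmodule (Fin (N + 1)) k) →+*ᵍ (homogeneousSubmodule (Fin (r + 1)) k))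
  (hfk' : HomogeneousIdeal.irrelevant (homogeneousSubmodule (Fin (r + 1)) k) ≤
    (HomogeneousIdeal.irrelevant (homogeneousSubmodule (Fin (N + 1)) k)).map fk)
  (hfkC : ∀ a : k, fk (C a) = C a) (hfke : ∀ j : Fin (r + 1), fk (X (e j)) = X j)
  (hfk0 : ∀ i : Fin (N + 1), i ∉ Set.range e → fk (X i) = 0)

include hφ hfOC hfOe hfO0 hfkC hfke hfk0 hπ in
/-- `g⁻¹ (supp Λ) = supp Λ_k` for `g = Proj φ` the special fibre of `ℙ^N_O`. [folklore] -/
theorem preimage_support :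
    (Proj.map φ hφ') ⁻¹' ((Proj.map fO hfO').ker.support : Set (Proj (homogeneousSubmodule (Fin (N + 1)) O))) =
      ((Proj.map fk hfk').ker.support : Set (Proj (homogeneousSubmodule (Fin (N + 1)) k))) := by
  have h := Scheme.IdealSheafData.support_comap (Proj.map fO hfO').ker (Proj.map φ hφ')
  rw [← ker_projMap_kill_eq_comap π hπ e φ hφ hφ' fO hfO' hfOC hfOe hfO0 fk hfk' hfkC hfke hfk0] at h
  rw [h]
  rfl

end SpecialFibre

section SpecialFibreField

variable {O : Type} [CommRing O] {N : ℕ}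

/-- `Spec π : Spec k → Spec O` collapses onto the closed point (`O` local, `k` a field, `π` surjective). [folklore] -/
theorem specMap_apply_eq_closedPoint [IsLocalRing O] {K : Type} [Field K] (ψ : O →+* K)
    (hψ : Function.Surjective ψ) (x : Spec (.of K)) :
    Spec.map (CommRingCat.ofHom ψ) x = IsLocalRing.closedPoint O := by
  rw [Spec.map_apply]
  apply PrimeSpectrum.ext
  rw [PrimeSpectrum.comap_asIdeal, CommRingCat.hom_ofHom, Ideal.eq_bot_of_prime x.asIdeal,
    ← RingHom.ker_eq_comap_bot]
  exact IsLocalRing.eq_maximalIdeal (RingHom.ker_isMaximal_of_surjective ψ hψ)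

/-- **The special fibre of `ℙ^N_O → Spec O` is the image of `g = Proj φ : ℙ^N_k → ℙ^N_O`** (`O` local, `k` a field,
`π : O → k` surjective): `ℙ^N_k = ℙ^N_O ×_O k` (`ProjectiveAmbientFibre.isPullback_projMap`). Transcribed from the proof of
`stub_projectiveAmbientFibre` (p160143). [cite: Liu2002, Prop. 3.1.9 and Ex. 3.1.10] -/
theorem range_projMap_eq_specialFibre [IsLocalRing O] {K : Type} [Field K] (ψ : O →+* K)
    (hψ : Function.Surjective ψ)
    (Φ : (homogeneousSubmodule (Fin (N + 1)) O) →+*ᵍ (homogeneousSubmodule (Fin (N + 1)) K))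
    (hΦ : ∀ q, Φ q = MvPolynomial.map ψ q)
    (hΦ' : HomogeneousIdeal.irrelevant (homogeneousSubmodule (Fin (N + 1)) K) ≤
      (HomogeneousIdeal.irrelevant (homogeneousSubmodule (Fin (N + 1)) O)).map Φ) :
    Set.range (Proj.map Φ hΦ') =
      (Proj.toSpecZero (homogeneousSubmodule (Fin (N + 1)) O) ≫
          Spec.map (CommRingCat.ofHom (algebraMap O ((homogeneousSubmodule (Fin (N + 1)) O) 0)))) ⁻¹'
        {IsLocalRing.closedPoint O} := by
  have hP := ProjectiveAmbientFibre.isPullback_projMap ψ Φ hΦ hψ hΦ'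
  set q := Proj.toSpecZero (homogeneousSubmodule (Fin (N + 1)) O) ≫
    Spec.map (CommRingCat.ofHom (algebraMap O ((homogeneousSubmodule (Fin (N + 1)) O) 0))) with hq
  set g := Proj.map Φ hΦ' with hg
  have hpt := specMap_apply_eq_closedPoint ψ hψ
  have hgq : ∀ x, q (g x) = IsLocalRing.closedPoint O := fun x ↦
    (Scheme.Hom.comp_apply g q x).symm.trans
      ((congrArg (fun h : Proj (homogeneousSubmodule (Fin (N + 1)) K) ⟶ Spec (.of O) ↦ h x) hP.w).trans
        ((Scheme.Hom.comp_apply _ _ x).trans (hpt _)))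
  refine Set.ext fun y ↦ ⟨?_, fun hy ↦ ?_⟩
  · rintro ⟨x, rfl⟩
    exact hgq x
  · have hy' : q y = IsLocalRing.closedPoint O := hy
    obtain ⟨x, hx, -⟩ := Scheme.exists_preimage_of_isPullback hP y default (hy'.trans (hpt default).symm)
    exact ⟨x, hx⟩

end SpecialFibreField

section SpecialFibreCentre

variable {O k : Type} [CommRing O] [IsLocalRing O] [Field k] (π : O →+* k) (hπ : Function.Surjective π) {N r : ℕ}
  (e : Fin (r + 1) → Fin (N + 1))
  (φ : (homogeneousSubmodule (Fin (N + 1)) O) →+*ᵍ (homogeneousSubmodule (Fin (N + 1)) k))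
  (hφ : ∀ q, φ q = MvPolynomial.map π q)
  (hφ' : HomogeneousIdeal.irrelevant (homogeneousSubmodule (Fin (N + 1)) k) ≤
    (HomogeneousIdeal.irrelevant (homogeneousSubmodule (Fin (N + 1)) O)).map φ)
  (fO : (homogeneousSubmodule (Fin (N + 1)) O) →+*ᵍ (homogeneousSubmodule (Fin (r + 1)) O))
  (hfO' : HomogeneousIdeal.irrelevant (homogeneousSubmodule (Fin (r + 1)) O) ≤
    (HomogeneousIdeal.irrelevant (homogeneousSubmodule (Fin (N + 1)) O)).map fO)
  (hfOC : ∀ a : O, fO (C a) = C a) (hfOe : ∀ j : Fin (r + 1), fO (X (e j)) = X j)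
  (hfO0 : ∀ i : Fin (N + 1), i ∉ Set.range e → fO (X i) = 0)
  (fk : (homogeneousSubmodule (Fin (N + 1)) k) →+*ᵍ (homogeneousSubmodule (Fin (r + 1)) k))
  (hfk' : HomogeneousIdeal.irrelevant (homogeneousSubmodule (Fin (r + 1)) k) ≤
    (HomogeneousIdeal.irrelevant (homogeneousSubmodule (Fin (N + 1)) k)).map fk)
  (hfkC : ∀ a : k, fk (C a) = C a) (hfke : ∀ j : Fin (r + 1), fk (X (e j)) = X j)
  (hfk0 : ∀ i : Fin (N + 1), i ∉ Set.range e → fk (X i) = 0)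

include hφ hfOC hfOe hfO0 hfkC hfke hfk0 hπ in
/-- **The special fibre of the linear centre is the `k`-linear subspace**: `supp Λ ∩ q⁻¹{s₀} = g (supp Λ_k)` (`O` local,
`k` a field). [folklore] -/
theorem support_inter_specialFibre :
    ((Proj.map fO hfO').ker.support : Set (Proj (homogeneousSubmodule (Fin (N + 1)) O))) ∩
        (Proj.toSpecZero (homogeneousSubmodule (Fin (N + 1)) O) ≫
            Spec.map (CommRingCat.ofHom (algebraMap O ((homogeneousSubmodule (Fin (N + 1)) O) 0)))) ⁻¹'
          {IsLocalRing.closedPoint O} =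
      (Proj.map φ hφ') '' ((Proj.map fk hfk').ker.support : Set (Proj (homogeneousSubmodule (Fin (N + 1)) k))) := by
  rw [← range_projMap_eq_specialFibre π hπ φ hφ hφ',
    ← preimage_support π hπ e φ hφ hφ' fO hfO' hfOC hfOe hfO0 fk hfk' hfkC hfke hfk0, Set.image_preimage_eq_inter_range]

include hφ hfOC hfOe hfO0 hfkC hfke hfk0 hπ in
/-- **E1 at level 0 for the linear centre**: if the `k`-linear subspace `supp Λ_k` lies on `H` (inside `range ι`), then the
special-fibre points of `supp Λ` lie in `Y = range (ι ≫ g)` — the clause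
`(C.support) ∩ (𝟙 ≫ q)⁻¹{s₀} ⊆ Y` of a HorizChainE1 step from `(ℙ^N_O, 𝟙, Y)`. [folklore] -/
theorem support_inter_specialFibre_subset_range {H : Scheme.{0}}
    (ι : H ⟶ Proj (homogeneousSubmodule (Fin (N + 1)) k))
    (hΛk : ((Proj.map fk hfk').ker.support : Set (Proj (homogeneousSubmodule (Fin (N + 1)) k))) ⊆ Set.range ι) :
    ((Proj.map fO hfO').ker.support : Set (Proj (homogeneousSubmodule (Fin (N + 1)) O))) ∩
        (𝟙 (Proj (homogeneousSubmodule (Fin (N + 1)) O)) ≫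
          (Proj.toSpecZero (homogeneousSubmodule (Fin (N + 1)) O) ≫
            Spec.map (CommRingCat.ofHom (algebraMap O ((homogeneousSubmodule (Fin (N + 1)) O) 0))))) ⁻¹'
          {IsLocalRing.closedPoint O} ⊆
      Set.range (ι ≫ Proj.map φ hφ') := by
  rw [Category.id_comp, support_inter_specialFibre π hπ e φ hφ hφ' fO hfO' hfOC hfOe hfO0 fk hfk' hfkC hfke hfk0]
  rintro _ ⟨y, hy, rfl⟩
  obtain ⟨h, rfl⟩ := hΛk hy
  exact ⟨h, Scheme.Hom.comp_apply _ _ h⟩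

end SpecialFibreCentre

/-! ## Off the generic point of `Y`; the bundled step data -/

section OffGeneric

variable {O k : Type} [CommRing O] [Field k] (π : O →+* k) (hπ : Function.Surjective π) {N r : ℕ}
  (e : Fin (r + 1) → Fin (N + 1))
  (φ : (homogeneousSubmodule (Fin (N + 1)) O) →+*ᵍ (homogeneousSubmodule (Fin (N + 1)) k))
  (hφ : ∀ q, φ q = MvPolynomial.map π q)
  (hφ' : HomogeneousIdeal.irrelevant (homogeneousSubmodule (Fin (N + 1)) k) ≤
    (HomogeneousIdeal.irrelevant (homogeneousSubmodule (Fin (N + 1)) O)).map φ)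
  (fO : (homogeneousSubmodule (Fin (N + 1)) O) →+*ᵍ (homogeneousSubmodule (Fin (r + 1)) O))
  (hfO' : HomogeneousIdeal.irrelevant (homogeneousSubmodule (Fin (r + 1)) O) ≤
    (HomogeneousIdeal.irrelevant (homogeneousSubmodule (Fin (N + 1)) O)).map fO)
  (hfOC : ∀ a : O, fO (C a) = C a) (hfOe : ∀ j : Fin (r + 1), fO (X (e j)) = X j)
  (hfO0 : ∀ i : Fin (N + 1), i ∉ Set.range e → fO (X i) = 0)
  (fk : (homogeneousSubmodule (Fin (N + 1)) k) →+*ᵍ (homogeneousSubmodule (Fin (r + 1)) k))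
  (hfk' : HomogeneousIdeal.irrelevant (homogeneousSubmodule (Fin (r + 1)) k) ≤
    (HomogeneousIdeal.irrelevant (homogeneousSubmodule (Fin (N + 1)) k)).map fk)
  (hfkC : ∀ a : k, fk (C a) = C a) (hfke : ∀ j : Fin (r + 1), fk (X (e j)) = X j)
  (hfk0 : ∀ i : Fin (N + 1), i ∉ Set.range e → fk (X i) = 0)

include hφ hfOC hfOe hfO0 hfkC hfke hfk0 hπ in
/-- **The linear centre is off the generic point of `Y`** (the HorizChainE1 «off-generic» clause at level 0, `σ' = 𝟙`): for
an integral `H` with a closed immersion `ι : H → ℙ^N_k` and `Y = range (ι ≫ g)`, if some point of `H` is off the `k`-linear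
subspace `supp Λ_k` then no point of `supp Λ` is the generic point of `Y` (that generic point is `g (ι η_H)`, and
`g⁻¹ supp Λ = supp Λ_k` is closed, so it would contain all of `ι(H)`).
Transcribed from `EL_of_linearCentre` (p-tree). [folklore] -/
theorem image_support_subset_nonGeneric {H : Scheme.{0}} [IsIntegral H]
    (ι : H ⟶ Proj (homogeneousSubmodule (Fin (N + 1)) k)) [IsClosedImmersion ι]
    (hh : ∃ h : H, ι h ∉ ((Proj.map fk hfk').ker.support : Set (Proj (homogeneousSubmodule (Fin (N + 1)) k)))) :
    (𝟙 (Proj (homogeneousSubmodule (Fin (N + 1)) O)) : _ ⟶ _) ''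
        ((Proj.map fO hfO').ker.support : Set (Proj (homogeneousSubmodule (Fin (N + 1)) O))) ⊆
      {x | ¬ IsGenericPoint x (Set.range (ι ≫ Proj.map φ hφ'))} := by
  set g := Proj.map φ hφ' with hg
  -- `g` is a closed immersion (base change of `Spec k → Spec O`)
  have hP := ProjectiveAmbientFibre.isPullback_projMap π φ hφ hπ hφ'
  haveI : IsClosedImmersion (Spec.map (CommRingCat.ofHom π)) := IsClosedImmersion.spec_of_surjective _ hπ
  haveI : IsClosedImmersion g := MorphismProperty.IsStableUnderBaseChange.of_isPullback hP.flip inferInstance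
  let f : H ⟶ Proj (homogeneousSubmodule (Fin (N + 1)) O) := ι ≫ g
  have hgenY : IsGenericPoint (f (genericPoint H)) (Set.range f) := by
    have h := (genericPoint_spec H).image f.continuous
    rwa [Set.image_univ, f.isClosedEmbedding.isClosed_range.closure_eq] at h
  have hgenj : IsGenericPoint (ι (genericPoint H)) (Set.range ι) := by
    have h := (genericPoint_spec H).image ι.continuous
    rwa [Set.image_univ, ι.isClosedEmbedding.isClosed_range.closure_eq] at h
  have hpreC := preimage_support π hπ e φ hφ hφ' fO hfO' hfOC hfOe hfO0 fk hfk' hfkC hfke hfk0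
  obtain ⟨a, ha⟩ := hh
  rintro _ ⟨x, hx, rfl⟩ hgx
  change IsGenericPoint x (Set.range f) at hgx
  have hxe : x = f (genericPoint H) := hgx.eq hgenY
  have hmem : ι (genericPoint H) ∈ g ⁻¹' ((Proj.map fO hfO').ker.support : Set _) := by
    change g (ι (genericPoint H)) ∈ ((Proj.map fO hfO').ker.support : Set _)
    rw [← Scheme.Hom.comp_apply, ← hxe]
    exact hx
  rw [hpreC] at hmem
  apply ha
  have hsub : Set.range ι ⊆ ((Proj.map fk hfk').ker.support : Set _) := by
    rw [← hgenj]
    exact closure_minimal (Set.singleton_subset_iff.mpr hmem) (Proj.map fk hfk').ker.support.isClosed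
  exact hsub ⟨a, rfl⟩

include hφ hfOC hfOe hfO0 hfkC hfke hfk0 hπ in
/-- **THE LINEAR CENTRE AS A LEVEL-0 HorizChainE1 STEP DATUM** (res-L1-w45b-plan-1 06:10:19Z): in the literal step-clause order
of `natChain_and_isIrreducible_of_horizChainE1` (p500485) with `σ' = 𝟙 P`, `Y' = Y = range (ι ≫ g)`: `V(Λ)` regular ∧
`V(Λ) → Spec O` flat ∧ `supp Λ` off the generic point of `Y` ∧ (E1) the special-fibre points of `supp Λ` lie in `Y` — given that
the `k`-linear subspace lies on `H` (`supp Λ_k ⊆ range ι`) and `H ⊄ supp Λ_k`. One `obtain` for R2 / T-ISO-0 / T-ISO-1. [folklore] -/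
theorem linearCentre_stepData [IsDomain O] [IsDiscreteValuationRing O] {H : Scheme.{0}} [IsIntegral H]
    (ι : H ⟶ Proj (homogeneousSubmodule (Fin (N + 1)) k)) [IsClosedImmersion ι]
    {Y : Set (Proj (homogeneousSubmodule (Fin (N + 1)) O))} (hY : Y = Set.range (ι ≫ Proj.map φ hφ'))
    (hΛk : ((Proj.map fk hfk').ker.support : Set (Proj (homogeneousSubmodule (Fin (N + 1)) k))) ⊆ Set.range ι)
    (hh : ∃ h : H, ι h ∉ ((Proj.map fk hfk').ker.support : Set (Proj (homogeneousSubmodule (Fin (N + 1)) k)))) :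
    Scheme.IsRegular (Proj.map fO hfO').ker.subscheme ∧
    Flat ((Proj.map fO hfO').ker.subschemeι ≫ 𝟙 _ ≫ (Proj.toSpecZero (homogeneousSubmodule (Fin (N + 1)) O) ≫
      Spec.map (CommRingCat.ofHom (algebraMap O ((homogeneousSubmodule (Fin (N + 1)) O) 0))))) ∧
    (𝟙 (Proj (homogeneousSubmodule (Fin (N + 1)) O)) : _ ⟶ _) ''
        ((Proj.map fO hfO').ker.support : Set (Proj (homogeneousSubmodule (Fin (N + 1)) O))) ⊆
      {x | ¬ IsGenericPoint x Y} ∧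
    ((Proj.map fO hfO').ker.support : Set (Proj (homogeneousSubmodule (Fin (N + 1)) O))) ∩
        (𝟙 (Proj (homogeneousSubmodule (Fin (N + 1)) O)) ≫
          (Proj.toSpecZero (homogeneousSubmodule (Fin (N + 1)) O) ≫
            Spec.map (CommRingCat.ofHom (algebraMap O ((homogeneousSubmodule (Fin (N + 1)) O) 0))))) ⁻¹'
          {IsLocalRing.closedPoint O} ⊆ Y := by
  subst hY
  exact ⟨isRegular_kerSubscheme e fO hfO' hfOC hfOe, flat_kerSubschemeι_comp_id e fO hfO' hfOC hfOe,
    image_support_subset_nonGeneric π hπ e φ hφ hφ' fO hfO' hfOC hfOe hfO0 fk hfk' hfkC hfke hfk0 ι hh,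
    support_inter_specialFibre_subset_range π hπ e φ hφ hφ' fO hfO' hfOC hfOe hfO0 fk hfk' hfkC hfke hfk0 ι hΛk⟩

end OffGeneric

end LinearCentre

end Summit.ResolutionOfSingularities.ResolutionOfSingularities.Cruxes.EquisingularLiftNat

end
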